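import Literature.MathematicalPhysics.StatisticalMechanics.Theil2006SimplexCover
import Literature.MathematicalPhysics.StatisticalMechanics.Theil2006ReferenceSurjectivity
import Literature.MathematicalPhysics.StatisticalMechanics.Theil2006LatticeClasses
import Literature.MathematicalPhysics.StatisticalMechanics.Theil2006SimplexDeficitCount
import Literature.MathematicalPhysics.StatisticalMechanics.Theil2006ReferenceUniqueness
import HarnessLib

/-!
# Theil 2006, Appendix p. 25: the coarse tiling by lattice classes and the measure bookkeeping (72)

MERGED FILING (lit-1 g53, 2026-08-25): verbatim concatenation (only `import` lines merged) of the
two separately lean-verified bricks staged as `Theil2006CoarseTiling` (row B) and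
`Theil2006MeasureBookkeeping` (row C) of the cell `pub-crystal3d` lit lane, filed as one module to
shorten the accept → build chain. Each part keeps its own module docstring below.
[cite: Theil2006, Appendix p. 25 display (72); §2.4 (27)]
-/

/-! # Part: staged brick `Theil2006CoarseTiling` (sha16 a0a43278df3c0c52) — verbatim -/

/-!
# Theil 2006, Appendix p. 25: the coarse triangles of one class tile (towards display (72))

Topic `Literature/MathematicalPhysics/StatisticalMechanics`; companion of `Theil2006.lean`
(F. Theil, *A proof of crystallization in two dimensions*, Comm. Math. Phys. **262** (2006)
209–236, accepted preprint of 26 Aug 2005), Appendix proof of Proposition 2.9 (27), display (72)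
(p. 25), with Proposition 4.8 (60)–(62) (p. 21) and (63).

## What this file proves

Fix a **rigid chart** (`Theil2006.IsRigidChart`): a discrete imbedding `Φ` (Definition 2.4) of a
defect-free disc patch `y⁻¹(B(c, r))` with the two-sided rigidity estimate (61),
`(1 − Kα)|y(x) − y(x′)| ≤ |Φ(x) − Φ(x′)| ≤ (1 + Kα)|y(x) − y(x′)|` — the output of Proposition 4.8.
Fix a class `κ` of equilateral lattice triangles of side `λ` (`Theil2006LatticeClasses.lean`: a
coset of a sub-lattice `η ℤ[ω]`, `|η| = λ`).  The **coarse triangles of class `κ`** are the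
triangles `conv y(T)`, `T` three particles of the disc whose labels `Φ(T)` form a unit triangle of
the coset.

KEY DEVICE (ours): the **rescaled class sub-configuration** `x ↦ λ⁻¹ y(x)` on the class-`κ`
particles of the disc (`Theil2006.classConfig`) is itself a configuration satisfying (13) with the
parameter `α′ = (2K + 1)α` whose short bonds are exactly the coarse class edges (labels at lattice
distance `λ`: `IsRigidChart.isShortRange_classConfig_iff`, from (61) and the fact that distances in a
coset are `0`, `λ` or `≥ √3 λ`), whose particles well inside the disc are not defects (the six coarse
neighbours are realized, (62): `IsRigidChart.not_mem_defectSet_classConfig`), and whose unit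
simplices are the coarse class triangles.  Hence the tree's theorems for unit simplices apply
verbatim at scale `λ`:

* `IsRigidChart.volume_inter_eq_zero_of_class` — two distinct coarse triangles of one class
  overlap in a Lebesgue-null set (`Theil2006.volume_convexHull_inter_convexHull_eq_zero`);
* `IsRigidChart.ball_subset_biUnion_class` — the coarse triangles of one class cover the inner disc
  ((63), `Theil2006.ball_subset_biUnion_convexHull`).

These are the two halves of "the class-`κ` coarse triangles tile", from which
`Theil2006MeasureBookkeeping.lean` derives (72).  Everything here is proved; the one `structure`
is a bundle of hypotheses (a predicate), not a named fact.
-/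
noncomputable section

namespace Literature.MathematicalPhysics.StatisticalMechanics

namespace Theil2006

open Set Metric MeasureTheory
open scoped Pointwise

/-! ### Rigid charts: a discrete imbedding of a defect-free disc with the two-sided estimate (61) -/

section RigidChart

variable {X : Type*}

/-- **A rigid chart**: a discrete imbedding `Φ` (Definition 2.4) of the disc patch `y⁻¹(B(c, r))`
with no defect within `r` of `c`, satisfying the rigidity estimate (61) of Proposition 4.8 in the
two-sided form `(1 − Kα)|y(x) − y(x′)| ≤ |Φ(x) − Φ(x′)| ≤ (1 + Kα)|y(x) − y(x′)|` — the output of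
Proposition 4.8 (existence, `Theil2006_existsRigidReference`) packaged as one hypothesis.
[cite: Theil2006, §4.2 Proposition 4.8 (61) (preprint p. 21)] -/
structure IsRigidChart (α K : ℝ) (y : X → Plane) (c : Plane) (r : ℝ) (Φ : X → ℤ × ℤ) : Prop where
  /-- `Φ` is a discrete imbedding of `y⁻¹(B(c, r))` -/
  imbedding : IsDiscreteImbeddingOn α y (y ⁻¹' ball c r) Φ
  /-- lower half of (61) -/
  lower : ∀ ⦃x x' : X⦄, y x ∈ ball c r → y x' ∈ ball c r →
    (1 - K * α) * dist (y x) (y x') ≤ dist (triPoint (Φ x)) (triPoint (Φ x'))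
  /-- upper half of (61) -/
  upper : ∀ ⦃x x' : X⦄, y x ∈ ball c r → y x' ∈ ball c r →
    dist (triPoint (Φ x)) (triPoint (Φ x')) ≤ (1 + K * α) * dist (y x) (y x')
  /-- no defect within `r` of `c` -/
  farDefects : ∀ b ∈ defectSet α y, r ≤ dist (y b) c

variable {α K lam r : ℝ} {y : X → Plane} {Φ : X → ℤ × ℤ} {c : Plane}

/-- Particles of the disc are not defects. [cite: Theil2006, §4.2 Proposition 4.8 (preprint p. 21)] -/
theorem IsRigidChart.not_mem_defectSet (H : IsRigidChart α K y c r Φ) {b : X} (hb : y b ∈ ball c r) :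
    b ∉ defectSet α y := fun hbd => by
  have := H.farDefects b hbd
  rw [mem_ball] at hb
  linarith

/-! ### The class sub-configuration of a rigid chart -/

/-- **The class-`κ` particles of the disc**: `y(x) ∈ B(c, r)` and `Φ(x)` in the coset of `κ`.
[cite: Theil2006, Appendix proof of Proposition 2.9 (27), display (72) (preprint p. 25); our
bookkeeping] -/
def classPatch (y : X → Plane) (Φ : X → ℤ × ℤ) (c : Plane) (r : ℝ) (κ : ClassIdx lam) : Set X :=
  {x | y x ∈ ball c r ∧ Φ x ∈ cosetOf κ}

/-- **The rescaled class sub-configuration** `x ↦ λ⁻¹ y(x)` on the class-`κ` particles of the disc: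
its short bonds are the coarse class-`κ` edges of length `≈ λ`, its unit simplices the coarse
class-`κ` triangles. [cite: Theil2006, Appendix display (72) (preprint p. 25); our construction] -/
def classConfig (y : X → Plane) (Φ : X → ℤ × ℤ) (c : Plane) (r : ℝ) (κ : ClassIdx lam) :
    ↥(classPatch y Φ c r κ) → Plane :=
  fun x => lam⁻¹ • y (x : X)

variable {κ : ClassIdx lam}

/-- Membership in the class patch. [cite: Theil2006, Appendix proof of Proposition 2.9 (27), display (72) (preprint p. 25); our lemma] -/
theorem mem_classPatch {x : X} : x ∈ classPatch y Φ c r κ ↔ y x ∈ ball c r ∧ Φ x ∈ cosetOf κ :=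
  Iff.rfl

/-- The class generator has length `λ ≥ 1`, so `λ > 0`. [cite: Theil2006, Appendix proof of Proposition 2.9 (27), display (72) (preprint p. 25); our lemma] -/
theorem ClassIdx.pos (κ : ClassIdx lam) : 0 < lam := by
  rw [← κ.norm_eq]
  exact lt_of_lt_of_le zero_lt_one (one_le_norm_triPoint κ.ne_zero)

/-- Distances in the rescaled sub-configuration. [cite: Theil2006, Appendix proof of Proposition 2.9 (27), display (72) (preprint p. 25); our lemma] -/
theorem dist_classConfig (a b : ↥(classPatch y Φ c r κ)) :
    dist (classConfig y Φ c r κ a) (classConfig y Φ c r κ b) = lam⁻¹ * dist (y a) (y b) := by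
  unfold classConfig
  rw [dist_smul₀, Real.norm_eq_abs, abs_of_pos (inv_pos.2 κ.pos)]

/-- **Distinct class-`κ` particles carry labels at lattice distance `≥ λ`.** [cite: Theil2006,
Appendix display (72) (preprint p. 25); our lemma] -/
theorem IsRigidChart.le_labelDist (H : IsRigidChart α K y c r Φ) {a b : ↥(classPatch y Φ c r κ)}
    (hab : a ≠ b) : lam ≤ dist (triPoint (Φ a)) (triPoint (Φ b)) := by
  refine le_dist_of_mem_cosetOf a.2.2 b.2.2 fun h => hab ?_
  exact Subtype.ext (H.imbedding.injOn a.2.1 b.2.1 h)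

/-- **(13) for the rescaled class sub-configuration** with `α′ = (2K + 1)α`: distinct particles are
at rescaled distance `> 1 − α′` (indeed `≥ 1/(1 + Kα)`). [cite: Theil2006, §2.2 (13) with Appendix
display (72) (preprint pp. 5, 25); our lemma] -/
theorem IsRigidChart.sep_classConfig (H : IsRigidChart α K y c r Φ) (hα : 0 < α) (hK : 0 ≤ K)
    (hKα : K * α ≤ 1 / 2) (a b : ↥(classPatch y Φ c r κ)) (hab : a ≠ b) :
    1 - (2 * K + 1) * α < dist (classConfig y Φ c r κ a) (classConfig y Φ c r κ b) := by
  rw [dist_classConfig]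
  have hlam := κ.pos
  have h1 := H.le_labelDist hab
  have h2 := H.upper a.2.1 b.2.1
  have hKα0 : 0 ≤ K * α := by positivity
  -- `λ ≤ (1 + Kα) d`, so `λ⁻¹ d ≥ 1/(1 + Kα) ≥ 1 − Kα > 1 − (2K+1)α`
  have h3 : lam ≤ (1 + K * α) * dist (y a) (y b) := h1.trans h2
  have hd := dist_nonneg (x := y a) (y := y b)
  have h4 : lam * (1 - K * α) ≤ dist (y ↑a) (y ↑b) := by
    have h5 := mul_le_mul_of_nonneg_left h3 (by linarith : (0 : ℝ) ≤ 1 - K * α)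
    nlinarith [mul_nonneg (mul_nonneg hKα0 hKα0) hd]
  have h6 : 0 < (K + 1) * α * lam := by positivity
  rw [inv_mul_eq_div, lt_div_iff₀ hlam]
  nlinarith

/-- **Short bonds of the rescaled class sub-configuration are exactly the coarse class edges**:
`| λ⁻¹|y(a) − y(b)| − 1 | ≤ α′` iff `|Φ(a) − Φ(b)| = λ` (`α′ = (2K+1)α ≤ 1/200`).
[cite: Theil2006, Appendix display (72) (preprint p. 25); our lemma] -/
theorem IsRigidChart.isShortRange_classConfig_iff (H : IsRigidChart α K y c r Φ) (hα : 0 < α)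
    (hK : 0 ≤ K) (hα' : (2 * K + 1) * α ≤ 1 / 200) (a b : ↥(classPatch y Φ c r κ)) :
    IsShortRange ((2 * K + 1) * α) (classConfig y Φ c r κ) a b ↔
      dist (triPoint (Φ a)) (triPoint (Φ b)) = lam := by
  have hlam := κ.pos
  have hKα0 : 0 ≤ K * α := by positivity
  have hKα : K * α ≤ 1 / 400 := by nlinarith
  unfold IsShortRange
  rw [dist_classConfig]
  constructor
  · intro h
    rw [abs_le] at h
    have hab : a ≠ b := by
      rintro rfl
      rw [dist_self, mul_zero] at h
      linarith [h.1]
    have hne : Φ a ≠ Φ b := fun e => hab (Subtype.ext (H.imbedding.injOn a.2.1 b.2.1 e))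
    refine dist_eq_of_dist_lt a.2.2 b.2.2 hne ?_
    have h2 := H.upper a.2.1 b.2.1
    -- `d ≤ (1 + α′) λ`, so `|Φa − Φb| ≤ (1 + Kα)(1 + α′) λ < √3 λ`
    have hd : dist (y ↑a) (y ↑b) ≤ (1 + (2 * K + 1) * α) * lam := by
      have := h.2
      rw [inv_mul_eq_div, sub_le_iff_le_add, div_le_iff₀ hlam] at this
      linarith
    have h3 : (173 / 100 : ℝ) < √3 := by
      rw [show (173 / 100 : ℝ) = √((173 / 100) ^ 2) by rw [Real.sqrt_sq]; norm_num]
      exact Real.sqrt_lt_sqrt (by norm_num) (by norm_num)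
    calc dist (triPoint (Φ ↑a)) (triPoint (Φ ↑b)) ≤ (1 + K * α) * dist (y ↑a) (y ↑b) := h2
      _ ≤ (1 + K * α) * ((1 + (2 * K + 1) * α) * lam) := by gcongr
      _ < √3 * lam := by
          rw [← mul_assoc]
          apply mul_lt_mul_of_pos_right _ hlam
          nlinarith
  · intro h
    have hab : a ≠ b := by
      rintro rfl
      rw [dist_self] at h
      exact absurd h (ne_of_lt hlam)
    have h1 := H.upper a.2.1 b.2.1
    have h2 := H.lower a.2.1 b.2.1
    rw [h] at h1 h2
    have hd0 : 0 ≤ dist (y ↑a) (y ↑b) := dist_nonneg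
    rw [abs_le, inv_mul_eq_div, le_sub_iff_add_le, sub_le_iff_le_add, le_div_iff₀ hlam,
      div_le_iff₀ hlam]
    constructor <;> nlinarith

/-- **The six coarse neighbours of a class-`κ` particle well inside the disc are realized** by
class-`κ` particles ((62), `exists_eq_of_dist_lt_half'`: the label `Φ(x) + R^j η` at lattice
distance `λ` is attained within `2λ` of `y(x)`). [cite: Theil2006, §4.2 Proposition 4.8 (3) (62)
(preprint p. 21); our lemma] -/
theorem IsRigidChart.exists_classNeighbour (H : IsRigidChart α K y c r Φ) (hα : 0 < α)
    (hα1 : α ≤ 1 / 200) (x : ↥(classPatch y Φ c r κ))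
    (hx : ball (y x) (21 / 10 * lam) ⊆ ball c r) (j : Fin 6) :
    ∃ x' : ↥(classPatch y Φ c r κ), Φ x' = Φ x + rotN j (κ.1 : ℤ × ℤ) := by
  have hlam := κ.pos
  have hball : ∀ b, dist (y b) (y x) < 21 / 10 * lam → b ∈ y ⁻¹' ball c r :=
    fun b hb => hx (mem_ball.2 hb)
  have hdef : ∀ b, dist (y b) (y x) < 21 / 10 * lam → b ∉ defectSet α y :=
    fun b hb => H.not_mem_defectSet (hx (mem_ball.2 hb))
  have hg : dist (triPoint (Φ x + rotN j (κ.1 : ℤ × ℤ))) (triPoint (Φ x)) < 21 / 10 * lam / 2 := by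
    rw [dist_add_rotN]
    linarith
  obtain ⟨x'', hd, hx''⟩ := H.imbedding.exists_eq_of_dist_lt_half' hα.le (by linarith) hball hdef hg
  have hx''ball : y x'' ∈ ball c r := by
    refine hx (mem_ball.2 (lt_of_le_of_lt hd ?_))
    rw [dist_add_rotN]
    linarith
  exact ⟨⟨x'', hx''ball, by rw [hx'']; exact add_rotN_mem_cosetOf x.2.2 j⟩, hx''⟩

/-- **A class-`κ` particle well inside the disc is not a defect of the rescaled class
sub-configuration**: its neighbourhood consists of itself and the six realized coarse neighbours.
[cite: Theil2006, §2.1 (∂X) with Appendix display (72) (preprint pp. 4, 25); our lemma] -/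
theorem IsRigidChart.not_mem_defectSet_classConfig (H : IsRigidChart α K y c r Φ) (hα : 0 < α)
    (hK : 0 ≤ K) (hα' : (2 * K + 1) * α ≤ 1 / 200) (x : ↥(classPatch y Φ c r κ))
    (hx : ball (y x) (21 / 10 * lam) ⊆ ball c r) :
    x ∉ defectSet ((2 * K + 1) * α) (classConfig y Φ c r κ) := by
  have hα1 : α ≤ 1 / 200 := by nlinarith
  choose p hp using fun j => H.exists_classNeighbour hα hα1 x hx j
  have hpinj : Function.Injective p := by
    intro i j hij
    have := add_rotN_injective κ (Φ x) (show Φ x + rotN i (κ.1 : ℤ × ℤ) = Φ x + rotN j (κ.1 : ℤ × ℤ)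
      by rw [← hp i, ← hp j, hij])
    exact this
  have hxp : (x : ↥(classPatch y Φ c r κ)) ∉ range p := by
    rintro ⟨j, hj⟩
    have h1 := hp j
    rw [hj] at h1
    have h2 : rotN j (κ.1 : ℤ × ℤ) = 0 := by
      have := h1.symm
      rwa [add_eq_left] at this
    exact rotN_ne_zero' j κ.ne_zero h2
  have hN : nbhdSet ((2 * K + 1) * α) (classConfig y Φ c r κ) x = insert x (range p) := by
    ext x'
    rw [mem_nbhdSet_iff, mem_insert_iff]
    constructor
    · rintro (rfl | hs)
      · exact Or.inl rfl
      · right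
        rw [H.isShortRange_classConfig_iff hα hK hα'] at hs
        obtain ⟨j, hj⟩ := exists_eq_add_rotN x.2.2 x'.2.2 (by rw [dist_comm]; exact hs)
        refine ⟨j, Subtype.ext (H.imbedding.injOn (p j).2.1 x'.2.1 ?_)⟩
        rw [hp j, hj]
    · rintro (rfl | ⟨j, rfl⟩)
      · exact Or.inl rfl
      · right
        rw [H.isShortRange_classConfig_iff hα hK hα', dist_comm, hp j]
        exact dist_add_rotN κ (Φ x) j
  rw [mem_defectSet_iff, not_not, hN, ncard_insert_of_notMem hxp (finite_range p),
    ← image_univ, ncard_image_of_injective _ hpinj, ncard_univ, Nat.card_fin]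

/-! ### Coarse class triangles = unit simplices of the rescaled class sub-configuration -/

/-- The rescaled image of a finset of class particles. [cite: Theil2006, Appendix proof of Proposition 2.9 (27), display (72) (preprint p. 25); our lemma] -/
theorem image_classConfig (T' : Finset ↥(classPatch y Φ c r κ)) :
    classConfig y Φ c r κ '' ↑T' =
      lam⁻¹ • (y '' ↑(T'.map (Function.Embedding.subtype _))) := by
  ext v
  simp only [mem_image, Finset.mem_coe, Finset.mem_map, Function.Embedding.coe_subtype,
    mem_smul_set, classConfig]
  constructor
  · rintro ⟨a, ha, rfl⟩
    exact ⟨y a, ⟨a, ⟨a, ha, rfl⟩, rfl⟩, rfl⟩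
  · rintro ⟨w, ⟨b, ⟨a, ha, rfl⟩, rfl⟩, rfl⟩
    exact ⟨a, ha, rfl⟩

/-- The rescaled triangle is the scaled triangle. [cite: Theil2006, Appendix proof of Proposition 2.9 (27), display (72) (preprint p. 25); our lemma] -/
theorem convexHull_image_classConfig (T' : Finset ↥(classPatch y Φ c r κ)) :
    convexHull ℝ (classConfig y Φ c r κ '' ↑T') =
      lam⁻¹ • convexHull ℝ (y '' ↑(T'.map (Function.Embedding.subtype _))) := by
  rw [image_classConfig, convexHull_smul]

/-- **Unit simplices of the rescaled class sub-configuration are the coarse class triangles**: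
three class particles with labels pairwise at lattice distance `λ`.
[cite: Theil2006, §2.3 Definition 2.6 (λ = 1) with Appendix display (72) (preprint pp. 8, 25); our lemma] -/
theorem IsRigidChart.isEquilateralSimplex_classConfig_iff (H : IsRigidChart α K y c r Φ) (hα : 0 < α)
    (hK : 0 ≤ K) (hα' : (2 * K + 1) * α ≤ 1 / 200) (T' : Finset ↥(classPatch y Φ c r κ)) :
    IsEquilateralSimplex ((2 * K + 1) * α) (classConfig y Φ c r κ) 1 T' ↔
      T'.card = 3 ∧ ∀ a ∈ T', ∀ b ∈ T', a ≠ b → dist (triPoint (Φ a)) (triPoint (Φ b)) = lam := by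
  rw [isEquilateralSimplex_one_iff]
  refine and_congr Iff.rfl ⟨fun h a ha b hb hab => ?_, fun h a ha b hb hab => ?_⟩
  · exact (H.isShortRange_classConfig_iff hα hK hα' a b).1 (h a ha b hb hab)
  · exact (H.isShortRange_classConfig_iff hα hK hα' a b).2 (h a ha b hb hab)

end RigidChart

/-! ### The two tiling statements, in the original configuration -/

section Tiling

variable {X : Type*} {α K lam r : ℝ} {y : X → Plane} {Φ : X → ℤ × ℤ} {c : Plane} {κ : ClassIdx lam}

/-- Scaling by a non-zero factor preserves Lebesgue-null sets of the plane. [folklore] -/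
private theorem volume_smul_eq_zero_iff {s : Set Plane} {t : ℝ} (ht : t ≠ 0) :
    volume (t • s) = 0 ↔ volume s = 0 := by
  rw [Measure.addHaar_smul, mul_eq_zero, finrank_euclideanSpace_fin]
  constructor
  · rintro (h | h)
    · exfalso
      rw [ENNReal.ofReal_eq_zero, abs_pow] at h
      have : 0 < |t| ^ 2 := by positivity
      linarith
    · exact h
  · intro h; exact Or.inr h

/-- **Two distinct coarse triangles of one class overlap in a null set.** For a rigid chart and two
finsets `T₁ ≠ T₂` of three class-`κ` particles each, labels pairwise at lattice distance `λ`, all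
vertices at least `(6/5)λ` inside the disc: `conv y(T₁) ∩ conv y(T₂)` is Lebesgue-null — the
rescaled class sub-configuration is a configuration with (13) whose unit simplices `T₁, T₂` have
non-defect vertices, and `Theil2006.volume_convexHull_inter_convexHull_eq_zero` applies.
[cite: Theil2006, Appendix proof of Proposition 2.9 (27), display (72) (preprint p. 25); our lemma] -/
theorem IsRigidChart.volume_inter_eq_zero_of_class (H : IsRigidChart α K y c r Φ) (hα : 0 < α)
    (hK : 0 ≤ K) (hα' : (2 * K + 1) * α ≤ 1 / 200) {T₁ T₂ : Finset X} (hne : T₁ ≠ T₂)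
    (h₁ : ∀ z ∈ T₁, z ∈ classPatch y Φ c r κ) (h₂ : ∀ z ∈ T₂, z ∈ classPatch y Φ c r κ)
    (hc₁ : T₁.card = 3) (hc₂ : T₂.card = 3)
    (hd₁ : ∀ z ∈ T₁, ∀ z' ∈ T₁, z ≠ z' → dist (triPoint (Φ z)) (triPoint (Φ z')) = lam)
    (hd₂ : ∀ z ∈ T₂, ∀ z' ∈ T₂, z ≠ z' → dist (triPoint (Φ z)) (triPoint (Φ z')) = lam)
    (hin₁ : ∀ z ∈ T₁, ball (y z) (21 / 10 * lam) ⊆ ball c r)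
    (hin₂ : ∀ z ∈ T₂, ball (y z) (21 / 10 * lam) ⊆ ball c r) :
    volume (convexHull ℝ (y '' ↑T₁) ∩ convexHull ℝ (y '' ↑T₂)) = 0 := by
  classical
  have hlam := κ.pos
  let T₁' : Finset ↥(classPatch y Φ c r κ) := T₁.subtype (· ∈ classPatch y Φ c r κ)
  let T₂' : Finset ↥(classPatch y Φ c r κ) := T₂.subtype (· ∈ classPatch y Φ c r κ)
  have hm₁ : T₁'.map (Function.Embedding.subtype _) = T₁ := Finset.subtype_map_of_mem h₁
  have hm₂ : T₂'.map (Function.Embedding.subtype _) = T₂ := Finset.subtype_map_of_mem h₂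
  have hne' : T₁' ≠ T₂' := fun h => hne (by rw [← hm₁, ← hm₂, h])
  have hα'0 : 0 < (2 * K + 1) * α := by positivity
  have hKα : K * α ≤ 1 / 2 := by nlinarith
  have hsep := H.sep_classConfig (κ := κ) hα hK hKα
  have hS : ∀ {T : Finset X} (T' : Finset ↥(classPatch y Φ c r κ)),
      T'.map (Function.Embedding.subtype _) = T →
      T.card = 3 → (∀ z ∈ T, ∀ z' ∈ T, z ≠ z' → dist (triPoint (Φ z)) (triPoint (Φ z')) = lam) →
      IsEquilateralSimplex ((2 * K + 1) * α) (classConfig y Φ c r κ) 1 T' := by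
    intro T T' hm hc hd
    rw [H.isEquilateralSimplex_classConfig_iff hα hK hα']
    refine ⟨by rw [← hc, ← hm, Finset.card_map], fun a ha b hb hab => hd a ?_ b ?_ ?_⟩
    · rw [← hm]; exact Finset.mem_map_of_mem _ ha
    · rw [← hm]; exact Finset.mem_map_of_mem _ hb
    · exact fun e => hab (Subtype.ext e)
  have hgood : ∀ {T : Finset X} (T' : Finset ↥(classPatch y Φ c r κ)),
      T'.map (Function.Embedding.subtype _) = T →
      (∀ z ∈ T, ball (y z) (21 / 10 * lam) ⊆ ball c r) →
      ∀ v ∈ T', v ∉ defectSet ((2 * K + 1) * α) (classConfig y Φ c r κ) := by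
    intro T T' hm hin v hv
    exact H.not_mem_defectSet_classConfig hα hK hα' v
      (hin v (by rw [← hm]; exact Finset.mem_map_of_mem _ hv))
  have h0 := volume_convexHull_inter_convexHull_eq_zero hα'0 hα' hsep (hS T₁' hm₁ hc₁ hd₁)
    (hS T₂' hm₂ hc₂ hd₂) hne' (hgood T₁' hm₁ hin₁) (hgood T₂' hm₂ hin₂)
  rw [convexHull_image_classConfig, convexHull_image_classConfig, hm₁, hm₂,
    ← smul_set_inter₀ (inv_ne_zero hlam.ne'), volume_smul_eq_zero_iff (inv_ne_zero hlam.ne')] at h0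
  exact h0

/-- **The coarse triangles of one class cover**: for a rigid chart, a class `κ` with a class
particle `x₀` in `B(c, λ r′)`, and `(r′ + 41/10) λ ≤ r`, the disc `B(c, λ r′)` is covered by the
triangles `conv y(T)` of three class-`κ` particles of `B(c, (r′ + 2)λ)` with labels pairwise at
lattice distance `λ` ((63) for the rescaled class sub-configuration,
`Theil2006.ball_subset_biUnion_convexHull`).
[cite: Theil2006, §4.2 (63) with Appendix display (72) (preprint pp. 21, 25); our lemma] -/
theorem IsRigidChart.ball_subset_biUnion_class [Finite X] (H : IsRigidChart α K y c r Φ) (hα : 0 < α)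
    (hK : 0 ≤ K) (hα' : (2 * K + 1) * α ≤ 1 / 200) {r' : ℝ} (hr' : (r' + 41 / 10) * lam ≤ r)
    {x₀ : X} (hx₀ : x₀ ∈ classPatch y Φ c r κ) (hx₀' : y x₀ ∈ ball c (lam * r')) :
    ball c (lam * r') ⊆ ⋃ T ∈ {T : Finset X | (∀ z ∈ T, z ∈ classPatch y Φ c r κ) ∧ T.card = 3 ∧
        (∀ z ∈ T, ∀ z' ∈ T, z ≠ z' → dist (triPoint (Φ z)) (triPoint (Φ z')) = lam) ∧
        ∀ z ∈ T, y z ∈ ball c (lam * (r' + 2))},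
      convexHull ℝ (y '' ↑T) := by
  classical
  have hlam := κ.pos
  have hα'0 : 0 < (2 * K + 1) * α := by positivity
  have hKα : K * α ≤ 1 / 2 := by nlinarith
  have hsep := H.sep_classConfig (κ := κ) hα hK hKα
  -- rescaled balls
  have hball : ∀ (v : Plane) (ρ : ℝ), lam⁻¹ • v ∈ ball (lam⁻¹ • c) ρ ↔ v ∈ ball c (lam * ρ) := by
    intro v ρ
    rw [mem_ball, mem_ball, dist_smul₀, Real.norm_eq_abs, abs_of_pos (inv_pos.2 hlam),
      inv_mul_eq_div, div_lt_iff₀' hlam]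
  -- no defect of the rescaled class sub-configuration within `r′ + 2` of `c′`
  have hdef : ∀ b ∈ defectSet ((2 * K + 1) * α) (classConfig y Φ c r κ),
      r' + 2 ≤ dist (classConfig y Φ c r κ b) (lam⁻¹ • c) := by
    intro b hb
    by_contra hlt
    rw [not_le] at hlt
    have hsub : ball (y b) (21 / 10 * lam) ⊆ ball c r := by
      intro v hv
      have h1 : y b ∈ ball c (lam * (r' + 2)) := (hball (y b) (r' + 2)).1 (mem_ball.2 hlt)
      rw [mem_ball] at h1 hv ⊢
      calc dist v c ≤ dist v (y b) + dist (y b) c := dist_triangle _ _ _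
        _ < 21 / 10 * lam + lam * (r' + 2) := by linarith
        _ ≤ r := by nlinarith
    exact H.not_mem_defectSet_classConfig hα hK hα' b hsub hb
  have hx₀ys : classConfig y Φ c r κ ⟨x₀, hx₀⟩ ∈ ball (lam⁻¹ • c) r' := (hball (y x₀) r').2 hx₀'
  have hcov := ball_subset_biUnion_convexHull hα'0 hα' hsep (le_refl (r' + 2)) hdef hx₀ys
  intro ξ hξ
  have hξ' : lam⁻¹ • ξ ∈ ball (lam⁻¹ • c) r' := (hball ξ r').2 hξ
  obtain ⟨T', hT', hξT'⟩ := mem_iUnion₂.1 (hcov hξ')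
  obtain ⟨hT'1, hT'R⟩ := hT'
  rw [convexHull_image_classConfig, smul_mem_smul_set_iff₀ (inv_ne_zero hlam.ne')] at hξT'
  refine mem_iUnion₂.2 ⟨T'.map (Function.Embedding.subtype _), ⟨?_, ?_, ?_, ?_⟩, hξT'⟩
  · intro z hz
    rw [Finset.mem_map] at hz
    obtain ⟨a, -, rfl⟩ := hz
    exact a.2
  · rw [Finset.card_map]; exact hT'1.card_eq_three
  · intro z hz z' hz' hzz'
    rw [Finset.mem_map] at hz hz'
    obtain ⟨a, ha, rfl⟩ := hz
    obtain ⟨b, hb, rfl⟩ := hz'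
    have hab : a ≠ b := fun e => hzz' (by rw [e])
    rw [H.isEquilateralSimplex_classConfig_iff hα hK hα'] at hT'1
    exact hT'1.2 a ha b hb hab
  · intro z hz
    rw [Finset.mem_map] at hz
    obtain ⟨a, ha, rfl⟩ := hz
    exact (hball (y a) (r' + 2)).1 (hT'R a ha)

end Tiling

end Theil2006

end Literature.MathematicalPhysics.StatisticalMechanics

/-! # Part: staged brick `Theil2006MeasureBookkeeping` (sha16 148b7edf3fb46181) — verbatim -/

/-!
# Theil 2006, Appendix p. 25, display (72): the measure bookkeeping of the proof of
Proposition 2.9 (27) — proved from Proposition 4.8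

Topic `Literature/MathematicalPhysics/StatisticalMechanics`; companion of `Theil2006.lean`
(F. Theil, *A proof of crystallization in two dimensions*, Comm. Math. Phys. **262** (2006)
209–236, accepted preprint of 26 Aug 2005), Appendix, proof of Proposition 2.9, display (72)
(p. 25).

## Source, as printed

«For each simplex `S ∈ 𝒯₁` and `λ ∈ Λ` we define the number
`n(S, λ) = (1 / meas(S)) Σ_{T ∈ 𝒯_λ} meas(S ∩ T) ∈ ℝ`.  Note that `n(S, λ) ≤ λ² m(λ)` and
(72) `n(S, λ) = λ² m(λ)` if `dist(y(S), y(∂X)) > 28λ`.  (Indeed, there are precisely `6 m(λ)`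
sets `{η₁, η₂, η₃} ⊂ A₂` which have the property `|η_i − η_j| = λ` …)»

## What this file proves

* `Theil2006.sum_volume_inter_le` — the upper half
  `Σ_{T ∈ 𝒯_λ(y)} meas(conv y(S) ∩ conv y(T)) ≤ m(λ) λ² meas(conv y(S))` for every unit simplex `S`;
* `Theil2006.le_sum_volume_inter` — the lower half (`≥`) when `dist(y(S), y(∂X)) > 28λ`;
* `Theil2006.measureBookkeeping_of_existsRigid` — both, packaged EXACTLY as hypothesis (H72) of
  `Theil2006_mainTheorems_of_existsRigidReference` (`Theil2006FromReferences.lean`), from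
  hypothesis (H48′) of the same theorem (Proposition 4.8: existence of discrete imbeddings of
  defect-free discs with (61) — itself a theorem, `Theil2006_existsRigidReference` of
  `Theil2006ExistsReference.lean`; the unconditional corollary is stated there-after, to keep this
  file's imports built).

all for `0 < α < α₂` (`α₂` depending only on the constant `K` of (61)), finite configurations with
(13), `λ ∈ Λ ∖ {1}`, and `𝒯_λ(y)` = the tree's centred simplices `Theil2006.simplicesAt`
(Definition 2.6 with the centring clause, `Theil2006SimplexDeficitCount.lean`).

## Proof (ours — the printed parenthesis counts corners, while `n(S, λ)` is measure-weighted)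

Upper half: if some `T ∈ 𝒯_λ` meets `conv y(S)` in positive measure then, by Definition 2.6 (no
defect within `20λ` of the barycentre), ONE rigid chart `Φ` about `y(s₁)` of radius `≈ 4.75λ`
(Proposition 4.8) contains every such `T`; by (60) (`Theil2006.discreteImbedding_unique_ball`,
applied on `B(z_T, λ + ½)` to `Φ_T` and `Φ`) the labels `Φ(T)` form an equilateral lattice
triangle of side `λ`, which has a class `κ(T) ∈ ClassIdx λ` (`Theil2006LatticeClasses.lean`,
`m(λ)λ²` classes); within one class the coarse triangles overlap in null sets
(`Theil2006CoarseTiling.lean`), so each class contributes at most `meas(conv y(S))`.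
Lower half: one rigid chart of radius `7λ − ½`; every class has a particle within `2λ` of `y(s₁)`
(cosets are `λ`-dense + (62)); the coarse triangles of each class cover `conv y(S)` ((63) at scale
`λ`); each of them is a centred `λ`-simplex of `y` (Definition 2.6 witnessed by a second chart
about its barycentre, (23) by (60)); different classes give different simplices.  Radii are ours.
Everything here is proved; no named facts.
-/

noncomputable section

namespace Literature.MathematicalPhysics.StatisticalMechanics

namespace Theil2006

open Set Metric MeasureTheory
open scoped Pointwise

variable {α K : ℝ} {N : ℕ} {y : Fin N → Plane}

/-! ### Rigid charts from Proposition 4.8 -/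

/-- The tree's finset `defects` and the set `defectSet` have the same members. [folklore] -/
private theorem mem_defects_iff_defectSet {b : Fin N} : b ∈ defects α y ↔ b ∈ defectSet α y := by
  rw [← Finset.mem_coe, coe_defects]

/-- **A rigid chart from Proposition 4.8 in the (H48′) form**: a discrete imbedding of the disc patch
with the quotient form of (61) is a rigid chart. [cite: Theil2006, §4.2 Proposition 4.8 (61)
(preprint p. 21)] -/
theorem isRigidChart_of_quotient (hα1 : α < 1)
    (hsep : ∀ i j : Fin N, i ≠ j → 1 - α < dist (y i) (y j)) {c : Plane} {r : ℝ} {Φ : Fin N → ℤ × ℤ}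
    (hΦ : IsDiscreteImbeddingOn α y (y ⁻¹' ball c r) Φ)
    (h61 : ∀ x x' : Fin N, y x ∈ ball c r → y x' ∈ ball c r → x ≠ x' →
      |dist (triPoint (Φ x)) (triPoint (Φ x')) / dist (y x) (y x') - 1| ≤ K * α)
    (hdef : ∀ b ∈ defectSet α y, r ≤ dist (y b) c) : IsRigidChart α K y c r Φ := by
  have key : ∀ ⦃x x' : Fin N⦄, y x ∈ ball c r → y x' ∈ ball c r →
      (1 - K * α) * dist (y x) (y x') ≤ dist (triPoint (Φ x)) (triPoint (Φ x')) ∧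
        dist (triPoint (Φ x)) (triPoint (Φ x')) ≤ (1 + K * α) * dist (y x) (y x') := by
    intro x x' hx hx'
    by_cases hxx' : x = x'
    · subst hxx'; simp
    have hd : 0 < dist (y x) (y x') := by
      have := hsep x x' hxx'; linarith
    have h := h61 x x' hx hx' hxx'
    rw [abs_le] at h
    obtain ⟨h1, h2⟩ := h
    rw [le_sub_iff_add_le, le_div_iff₀ hd] at h1
    rw [sub_le_iff_le_add, div_le_iff₀ hd] at h2
    constructor <;> linarith
  exact ⟨hΦ, fun x x' hx hx' => (key hx hx').1, fun x x' hx hx' => (key hx hx').2, hdef⟩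

/-! ### Elementary geometry of triangles -/

/-- A point of `conv y(T)` is as close to `q` as the farthest vertex. [cite: Theil2006, Appendix proof of Proposition 2.9 (27), display (72) (preprint p. 25); our lemma] -/
theorem dist_le_of_mem_convexHull_of_forall {X : Type*} {y : X → Plane} {T : Finset X} {q p : Plane}
    {L : ℝ} (hT : ∀ t ∈ T, dist (y t) q ≤ L) (hp : p ∈ convexHull ℝ (y '' ↑T)) : dist p q ≤ L := by
  have hsub : convexHull ℝ (y '' ↑T) ⊆ closedBall q L := by
    refine convexHull_min ?_ (convex_closedBall q L)
    rintro _ ⟨t, ht, rfl⟩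
    exact mem_closedBall.2 (hT t (Finset.mem_coe.1 ht))
  exact mem_closedBall.1 (hsub hp)

/-- In a triangle with sides `≤ L` every vertex is within `(2/3) L` of the barycentre. [cite: Theil2006, Appendix proof of Proposition 2.9 (27), display (72) (preprint p. 25); our lemma] -/
theorem dist_simplexCentre_le {X : Type*} [DecidableEq X] {y : X → Plane} {T : Finset X} {L : ℝ}
    (h3 : T.card = 3) (hL : ∀ t ∈ T, ∀ t' ∈ T, dist (y t) (y t') ≤ L) {t : X} (ht : t ∈ T) :
    dist (y t) (simplexCentre y T) ≤ 2 / 3 * L := by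
  obtain ⟨a, b, c, hab, hac, hbc, rfl⟩ := Finset.card_eq_three.1 h3
  have hs : simplexCentre y {a, b, c} = (3 : ℝ)⁻¹ • (y a + y b + y c) := by
    rw [simplexCentre, Finset.sum_insert (by simp [hab, hac]), Finset.sum_pair hbc, add_assoc]
  have key : ∀ {u v w : X}, u ∈ ({a, b, c} : Finset X) → v ∈ ({a, b, c} : Finset X) →
      w ∈ ({a, b, c} : Finset X) → y a + y b + y c = y u + y v + y w →
      dist (y u) (simplexCentre y {a, b, c}) ≤ 2 / 3 * L := by
    intro u v w hu hv hw hsum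
    rw [hs, hsum, dist_eq_norm]
    have : y u - (3 : ℝ)⁻¹ • (y u + y v + y w) = (3 : ℝ)⁻¹ • ((y u - y v) + (y u - y w)) := by
      module
    rw [this, norm_smul, Real.norm_eq_abs, abs_of_pos (by norm_num : (0 : ℝ) < 3⁻¹)]
    have h := norm_add_le (y u - y v) (y u - y w)
    rw [← dist_eq_norm, ← dist_eq_norm] at h
    have h1 := hL u hu v hv
    have h2 := hL u hu w hw
    linarith
  simp only [Finset.mem_insert, Finset.mem_singleton] at ht
  rcases ht with rfl | rfl | rfl
  · exact key (by simp) (by simp) (by simp) rfl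
  · exact key (u := t) (v := a) (w := c) (by simp) (by simp) (by simp) (by abel)
  · exact key (u := t) (v := a) (w := b) (by simp) (by simp) (by simp) (by abel)

/-- The triangle of a unit simplex lies within `1 + α` of each of its vertices. [cite: Theil2006,
§2.3 Definition 2.6, λ = 1 (preprint p. 8)] -/
theorem dist_le_of_mem_convexHull_unitSimplex {X : Type*} {y : X → Plane} {S : Finset X}
    (hα : 0 ≤ α) (hS : IsEquilateralSimplex α y 1 S) {s : X} (hs : s ∈ S) {p : Plane}
    (hp : p ∈ convexHull ℝ (y '' ↑S)) : dist p (y s) ≤ 1 + α := by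
  refine dist_le_of_mem_convexHull_of_forall (fun t ht => ?_) hp
  by_cases hts : t = s
  · rw [hts, dist_self]; linarith
  · exact ((isEquilateralSimplex_one_iff.1 hS).2 t ht s hs hts).dist_le

/-! ### The labels of a centred simplex under a rigid chart -/

/-- Linear isometries preserve lattice distances read through `rotPow`. [folklore] -/
private theorem dist_eq_of_rotPow {φ ψ : Fin N → ℤ × ℤ} {k : ℕ} {a b : Fin N}
    (h : triPoint (ψ a) - triPoint (ψ b) = rotPow k (triPoint (φ a) - triPoint (φ b))) :
    dist (triPoint (ψ a)) (triPoint (ψ b)) = dist (triPoint (φ a)) (triPoint (φ b)) := by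
  rw [dist_eq_norm, dist_eq_norm, h, LinearIsometryEquiv.norm_map]

/-- **A centred `λ`-simplex lying in the disc of a rigid chart has labels pairwise at lattice distance
`λ` under the chart** (uniqueness (60), `Theil2006.discreteImbedding_unique_ball`, applied on
`B(z_T, λ + ½)` to the simplex's own imbedding `Φ_T` and the chart). [cite: Theil2006, Appendix
Proposition 4.8 (1) (60) and §2.3 Definition 2.6 (23) (preprint pp. 8, 21); our lemma] -/
theorem IsRigidChart.labelDist_eq_of_isCentredSimplex {c : Plane} {r lam : ℝ} {Φ : Fin N → ℤ × ℤ}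
    (H : IsRigidChart α K y c r Φ) (hα : 0 < α) (hα' : α ≤ 1 / 200)
    (hsep : ∀ i j : Fin N, i ≠ j → 1 - α < dist (y i) (y j)) {T : Finset (Fin N)}
    (hT : IsCentredSimplex α y lam T) (hlam : √3 ≤ lam)
    (hsub : ball (simplexCentre y T) (lam + 1 / 2) ⊆ ball c r) :
    ∀ t ∈ T, ∀ t' ∈ T, t ≠ t' → dist (triPoint (Φ t)) (triPoint (Φ t')) = lam := by
  have h173 : (173 / 100 : ℝ) < √3 := by
    rw [show (173 / 100 : ℝ) = √((173 / 100) ^ 2) by rw [Real.sqrt_sq]; norm_num]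
    exact Real.sqrt_lt_sqrt (by norm_num) (by norm_num)
  have hlam1 : 1 < lam := by linarith
  obtain ⟨hE, hcen⟩ := hT
  rcases hE.2 with ⟨h1, -⟩ | ⟨-, hfar, ω, ΦT, -, hTω, hDI, h23, -, hω3⟩
  · exact absurd h1 (ne_of_gt hlam1)
  set z := simplexCentre y T with hz
  -- both imbeddings restrict to `y⁻¹(B(z, λ + ½))`
  have hρ2 : (2 : ℝ) ≤ lam + 1 / 2 := by linarith
  have hdef : ∀ b ∈ defectSet α y, lam + 1 / 2 + 2 ≤ dist (y b) z := fun b hb => by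
    have := hfar b hb; linarith
  have hωsub : y ⁻¹' ball z (lam + 1 / 2) ⊆ ω := by
    intro x hx
    have hx3 : y x ∈ closedBall z (3 * lam) ∩ range y :=
      ⟨mem_closedBall.2 (by have := mem_ball.1 hx; linarith), ⟨x, rfl⟩⟩
    obtain ⟨x', hx'ω, hx'y⟩ := hω3 hx3
    by_cases hxx : x' = x
    · rwa [← hxx]
    · exfalso
      have := hsep x' x hxx
      rw [hx'y, dist_self] at this
      linarith
  have hφ : IsDiscreteImbeddingOn α y (y ⁻¹' ball z (lam + 1 / 2)) ΦT := hDI.mono hωsub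
  have hψ : IsDiscreteImbeddingOn α y (y ⁻¹' ball z (lam + 1 / 2)) Φ :=
    H.imbedding.mono (preimage_mono hsub)
  obtain ⟨k, hk⟩ := discreteImbedding_unique_ball hα hα' hsep hρ2 hdef hφ hψ
  intro t ht t' ht' htt'
  have htb : y t ∈ ball z (lam + 1 / 2) := mem_ball.2 (by have := hcen hlam1 t ht; linarith)
  have htb' : y t' ∈ ball z (lam + 1 / 2) := mem_ball.2 (by have := hcen hlam1 t' ht'; linarith)
  rw [dist_eq_of_rotPow (hk t t' htb htb')]
  exact h23 t ht t' ht' htt'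

/-! ### Coarse class triangles far from the defects are `λ`-simplices -/

/-- **A coarse triangle is an equilateral `λ`-simplex (Definition 2.6, centred).** Three particles
with labels pairwise at lattice distance `λ` under a rigid chart of `B(c, r₁)`, positions in
`B(c, 4λ)`, `6λ + ½ ≤ r₁`, all defects farther than `28λ` from `c`, and Proposition 4.8
available at `α` (to produce the patch imbedding `Φ_T` on `B̄(z_T, 5λ)`): then
`T ∈ 𝒯_λ(y)`. [cite: Theil2006, §2.3 Definition 2.6 (23)–(24) (preprint p. 8); Appendix
Proposition 4.8 (p. 21); our lemma] -/
theorem IsRigidChart.isCentredSimplex_of_labels {c : Plane} {r₁ lam : ℝ} {Φ : Fin N → ℤ × ℤ}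
    (H : IsRigidChart α K y c r₁ Φ) (hα : 0 < α) (hK : 0 ≤ K) (hα' : (2 * K + 1) * α ≤ 1 / 200)
    (hsep : ∀ i j : Fin N, i ≠ j → 1 - α < dist (y i) (y j)) (hlam : √3 ≤ lam)
    (hr₁ : 6 * lam + 1 / 2 ≤ r₁) (hdef : ∀ b ∈ defectSet α y, 28 * lam ≤ dist (y b) c)
    (h48α : ∀ (c' : Plane) (r R : ℝ), 2 ≤ r → 4 * r + 2 ≤ R →
      (∀ b ∈ defectSet α y, R ≤ dist (y b) c') →
        ∃ Ψ : Fin N → ℤ × ℤ, IsDiscreteImbeddingOn α y (y ⁻¹' ball c' r) Ψ ∧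
          ∀ x x' : Fin N, y x ∈ ball c' r → y x' ∈ ball c' r → x ≠ x' →
            |dist (triPoint (Ψ x)) (triPoint (Ψ x')) / dist (y x) (y x') - 1| ≤ K * α)
    {T : Finset (Fin N)} (h3 : T.card = 3) (hball : ∀ t ∈ T, y t ∈ ball c (4 * lam))
    (hlab : ∀ t ∈ T, ∀ t' ∈ T, t ≠ t' → dist (triPoint (Φ t)) (triPoint (Φ t')) = lam) :
    IsCentredSimplex α y lam T := by
  classical
  have h173 : (173 / 100 : ℝ) < √3 := by
    rw [show (173 / 100 : ℝ) = √((173 / 100) ^ 2) by rw [Real.sqrt_sq]; norm_num]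
    exact Real.sqrt_lt_sqrt (by norm_num) (by norm_num)
  have hlam1 : 1 < lam := by linarith
  have hlam0 : 0 < lam := by linarith
  have hα1 : α < 1 := by nlinarith
  have hα200 : α ≤ 1 / 200 := by nlinarith
  have hKα0 : 0 ≤ K * α := by positivity
  have hKα : K * α ≤ 1 / 400 := by nlinarith
  -- side lengths `≤ 1.005 λ` from the lower half of (61)
  have hTr : ∀ t ∈ T, y t ∈ ball c r₁ := fun t ht =>
    ball_subset_ball (by linarith) (hball t ht)
  have hside : ∀ t ∈ T, ∀ t' ∈ T, dist (y t) (y t') ≤ 201 / 200 * lam := by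
    intro t ht t' ht'
    by_cases htt' : t = t'
    · rw [htt', dist_self]; positivity
    have h1 := H.lower (hTr t ht) (hTr t' ht')
    rw [hlab t ht t' ht' htt'] at h1
    nlinarith [dist_nonneg (x := y t) (y := y t')]
  set z := simplexCentre y T with hz
  have hcen : ∀ t ∈ T, dist (y t) z ≤ 2 / 3 * (201 / 200 * lam) := fun t ht =>
    dist_simplexCentre_le h3 hside ht
  -- the barycentre is within `4λ` of `c`
  obtain ⟨t₀, ht₀⟩ : T.Nonempty := by rw [← Finset.card_pos, h3]; norm_num
  have hzc : dist z c < 4 * lam + 2 / 3 * (201 / 200 * lam) := by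
    calc dist z c ≤ dist z (y t₀) + dist (y t₀) c := dist_triangle _ _ _
      _ < 2 / 3 * (201 / 200 * lam) + 4 * lam := by
          rw [dist_comm]; linarith [hcen t₀ ht₀, mem_ball.1 (hball t₀ ht₀)]
      _ = 4 * lam + 2 / 3 * (201 / 200 * lam) := by ring
  have hbz : ∀ b ∈ defectSet α y, 28 * lam - (4 * lam + 2 / 3 * (201 / 200 * lam)) < dist (y b) z := by
    intro b hb
    have h1 := hdef b hb
    have h2 : dist (y b) c ≤ dist (y b) z + dist z c := dist_triangle _ _ _
    linarith
  have hfar : ∀ b ∈ defectSet α y, 20 * lam < dist (y b) z := fun b hb => by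
    have := hbz b hb; linarith
  -- the patch imbedding `Φ_T` on `B(z, 5λ + ¼)` from Proposition 4.8
  obtain ⟨Ψ, hΨ, -⟩ := h48α z (5 * lam + 1 / 4) (4 * (5 * lam + 1 / 4) + 2) (by linarith) le_rfl
    (fun b hb => by have := hbz b hb; linarith)
  -- `Ψ` agrees with `Φ` up to a rigid motion on `B(z, λ + ½)`
  have hρ2 : (2 : ℝ) ≤ lam + 1 / 2 := by linarith
  have hdef' : ∀ b ∈ defectSet α y, lam + 1 / 2 + 2 ≤ dist (y b) z := fun b hb => by
    have := hfar b hb; linarith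
  have hsubz : ball z (lam + 1 / 2) ⊆ ball c r₁ := by
    refine fun v hv => mem_ball.2 ?_
    calc dist v c ≤ dist v z + dist z c := dist_triangle _ _ _
      _ < (lam + 1 / 2) + (4 * lam + 2 / 3 * (201 / 200 * lam)) := by
          linarith [mem_ball.1 hv]
      _ ≤ r₁ := by linarith
  have hφ : IsDiscreteImbeddingOn α y (y ⁻¹' ball z (lam + 1 / 2)) Ψ :=
    hΨ.mono (preimage_mono (ball_subset_ball (by linarith)))
  have hψ : IsDiscreteImbeddingOn α y (y ⁻¹' ball z (lam + 1 / 2)) Φ :=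
    H.imbedding.mono (preimage_mono hsubz)
  obtain ⟨k, hk⟩ := discreteImbedding_unique_ball hα hα200 hsep hρ2 hdef' hφ hψ
  have hTz : ∀ t ∈ T, y t ∈ ball z (lam + 1 / 2) := fun t ht =>
    mem_ball.2 (by linarith [hcen t ht])
  have h23 : ∀ t ∈ T, ∀ t' ∈ T, t ≠ t' → dist (triPoint (Ψ t)) (triPoint (Ψ t')) = lam := by
    intro t ht t' ht' htt'
    rw [← dist_eq_of_rotPow (hk t t' (hTz t ht) (hTz t' ht')), hlab t ht t' ht' htt']
  -- Definition 2.6 with `ω_T = y⁻¹(B̄(z, 5λ))`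
  refine ⟨⟨h3, Or.inr ⟨hlam1, hfar, y ⁻¹' closedBall z (5 * lam), Ψ, ?_, ?_, ?_, h23, ?_, ?_⟩⟩,
    fun _ t ht => by linarith [hcen t ht]⟩
  · exact Set.disjoint_left.2 fun x hx hxd => by
      have := hfar x hxd; have := mem_closedBall.1 hx; linarith
  · intro t ht
    exact mem_closedBall.2 (by linarith [hcen t (Finset.mem_coe.1 ht)])
  · exact hΨ.mono (preimage_mono (closedBall_subset_ball (by linarith)))
  · rintro _ ⟨x, hx, rfl⟩; exact hx
  · rintro _ ⟨hv, ⟨x, rfl⟩⟩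
    exact ⟨x, mem_closedBall.2 (by have := mem_closedBall.1 hv; linarith), rfl⟩

section UpperBound

variable {α K : ℝ} {N : ℕ} {y : Fin N → Plane}

/-- `√3 > 1.73`. [folklore] -/
private theorem sqrt_three_gt : (173 / 100 : ℝ) < √3 := by
  rw [show (173 / 100 : ℝ) = √((173 / 100) ^ 2) by rw [Real.sqrt_sq]; norm_num]
  exact Real.sqrt_lt_sqrt (by norm_num) (by norm_num)

/-- The triangle of a finite set of particles has finite area. [cite: Theil2006, Appendix proof of Proposition 2.9 (27), display (72) (preprint p. 25); our lemma] -/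
theorem volume_convexHull_lt_top (T : Finset (Fin N)) : volume (convexHull ℝ (y '' ↑T)) < ⊤ :=
  ((T.finite_toSet.image y).isCompact_convexHull ℝ).measure_lt_top

/-- The pieces `conv y(S) ∩ conv y(T)` are closed, hence measurable. [cite: Theil2006, Appendix proof of Proposition 2.9 (27), display (72) (preprint p. 25); our lemma] -/
theorem measurableSet_inter_convexHull (S T : Finset (Fin N)) :
    MeasurableSet (convexHull ℝ (y '' ↑S) ∩ convexHull ℝ (y '' ↑T)) :=
  ((((S.finite_toSet.image y).isCompact_convexHull ℝ).isClosed).inter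
    (((T.finite_toSet.image y).isCompact_convexHull ℝ).isClosed)).measurableSet

/-- **(72), upper half: `Σ_{T ∈ 𝒯_λ} meas(conv y(S) ∩ conv y(T)) ≤ m(λ) λ² meas(conv y(S))` for
every unit simplex `S`** — given Proposition 4.8 at `α` (rigid charts of defect-free discs).  The
long simplices meeting `conv y(S)` in positive measure lie in the disc of ONE rigid chart about
`y(s₁)` (Definition 2.6: no defect within `20λ` of their barycentres); by (60) their labels under the
chart are equilateral lattice triangles of side `λ`, which fall into at most `m(λ)λ²` classes; and the
coarse triangles of one class overlap in null sets (`IsRigidChart.volume_inter_eq_zero_of_class`).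
[cite: Theil2006, Appendix proof of Proposition 2.9 (27), display (72) (preprint p. 25); our proof] -/
theorem sum_volume_inter_le (hα : 0 < α) (hK : 0 ≤ K) (hα' : (2 * K + 1) * α ≤ 1 / 200)
    (hsep : ∀ i j : Fin N, i ≠ j → 1 - α < dist (y i) (y j))
    (h48α : ∀ (c' : Plane) (r R : ℝ), 2 ≤ r → 4 * r + 2 ≤ R →
      (∀ b ∈ defectSet α y, R ≤ dist (y b) c') →
        ∃ Ψ : Fin N → ℤ × ℤ, IsDiscreteImbeddingOn α y (y ⁻¹' ball c' r) Ψ ∧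
          ∀ x x' : Fin N, y x ∈ ball c' r → y x' ∈ ball c' r → x ≠ x' →
            |dist (triPoint (Ψ x)) (triPoint (Ψ x')) / dist (y x) (y x') - 1| ≤ K * α)
    {lam : ℝ} (hlam : √3 ≤ lam) {S : Finset (Fin N)} (hS : IsEquilateralSimplex α y 1 S) :
    ∑ T ∈ simplicesAt α y lam,
        (volume (convexHull ℝ (y '' ↑S) ∩ convexHull ℝ (y '' ↑T))).toReal ≤
      m lam * lam ^ 2 * (volume (convexHull ℝ (y '' ↑S))).toReal := by
  classical
  have h173 := sqrt_three_gt
  have hlam1 : 1 < lam := by linarith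
  have hlam0 : 0 < lam := by linarith
  have hα1 : α < 1 := by nlinarith
  have hα200 : α ≤ 1 / 200 := by nlinarith
  have hKα0 : 0 ≤ K * α := by positivity
  have hKα : K * α ≤ 1 / 400 := by nlinarith
  set CS := convexHull ℝ (y '' ↑S) with hCS
  set f : Finset (Fin N) → ℝ := fun T => (volume (CS ∩ convexHull ℝ (y '' ↑T))).toReal with hf
  have hf0 : ∀ T, 0 ≤ f T := fun T => ENNReal.toReal_nonneg
  have hμS : volume CS ≠ ⊤ := (volume_convexHull_lt_top S).ne
  have hRHS : 0 ≤ (m lam : ℝ) * lam ^ 2 * (volume CS).toReal := by positivity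
  -- trivial case: every term vanishes
  by_cases hex : ∃ T ∈ simplicesAt α y lam, f T ≠ 0
  swap
  · push Not at hex
    rw [Finset.sum_eq_zero hex]
    exact hRHS
  obtain ⟨T₀, hT₀, hfT₀⟩ := hex
  -- the centre `c = y(s₁)` and the chart
  obtain ⟨s₁, hs₁⟩ : S.Nonempty := by rw [← Finset.card_pos, hS.card_eq_three]; norm_num
  set c : Plane := y s₁ with hc
  have hpS : ∀ p ∈ CS, dist p c ≤ 1 + α := fun p hp =>
    dist_le_of_mem_convexHull_unitSimplex hα.le hS hs₁ hp
  -- geometry of a centred simplex meeting `conv y(S)`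
  have hne : ∀ T, f T ≠ 0 → (CS ∩ convexHull ℝ (y '' ↑T)).Nonempty := fun T hT =>
    nonempty_of_measure_ne_zero (μ := volume) fun h => hT (by
      show (volume (CS ∩ convexHull ℝ (y '' ↑T))).toReal = 0
      rw [h]; simp)
  have crude : ∀ T ∈ simplicesAt α y lam, f T ≠ 0 →
      (∀ b ∈ defectSet α y, 19 * lam - 1 - α < dist (y b) c) ∧
      dist (simplexCentre y T) c ≤ lam + 1 + α ∧ (∀ t ∈ T, dist (y t) c ≤ 2 * lam + 1 + α) := by
    intro T hT hfT
    obtain ⟨hE, hcen⟩ := mem_simplicesAt.1 hT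
    rcases hE.2 with ⟨h1, -⟩ | ⟨-, hfar, -⟩
    · exact absurd h1 (ne_of_gt hlam1)
    obtain ⟨p, hpS', hpT⟩ := hne T hfT
    have hpz : dist p (simplexCentre y T) ≤ lam :=
      dist_le_of_mem_convexHull_of_forall (fun t ht => hcen hlam1 t ht) hpT
    have hpc := hpS p hpS'
    have hzc : dist (simplexCentre y T) c ≤ lam + 1 + α := by
      have := dist_triangle (simplexCentre y T) p c
      rw [dist_comm] at hpz; linarith
    refine ⟨fun b hb => ?_, hzc, fun t ht => ?_⟩
    · have h1 := hfar b hb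
      have h2 := dist_triangle (y b) c (simplexCentre y T)
      rw [dist_comm c] at h2
      linarith
    · have := dist_triangle (y t) (simplexCentre y T) c
      linarith [hcen hlam1 t ht]
  -- the chart about `c`
  set r₀ : ℝ := (19 * lam - 4) / 4 with hr₀
  have hr₀2 : 2 ≤ r₀ := by rw [hr₀]; linarith
  obtain ⟨Φ, hΦ, h61⟩ := h48α c r₀ (19 * lam - 2) hr₀2 (by rw [hr₀]; linarith)
    (fun b hb => by have := (crude T₀ hT₀ hfT₀).1 b hb; linarith)
  have H : IsRigidChart α K y c r₀ Φ := isRigidChart_of_quotient hα1 hsep hΦ h61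
    (fun b hb => by have := (crude T₀ hT₀ hfT₀).1 b hb; rw [hr₀]; linarith)
  -- the long simplices with a non-zero term: labels form `λ`-triangles, vertices deep inside
  have good : ∀ T ∈ simplicesAt α y lam, f T ≠ 0 →
      T.card = 3 ∧ (∀ t ∈ T, y t ∈ ball c r₀) ∧
      (∀ t ∈ T, ∀ t' ∈ T, t ≠ t' → dist (triPoint (Φ t)) (triPoint (Φ t')) = lam) ∧
      (∀ t ∈ T, ball (y t) (21 / 10 * lam) ⊆ ball c r₀) := by
    intro T hT hfT
    have hTc := mem_simplicesAt.1 hT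
    obtain ⟨-, hzc, hvert⟩ := crude T hT hfT
    have h3 := hTc.1.card_eq_three
    have hball : ∀ t ∈ T, y t ∈ ball c r₀ := fun t ht =>
      mem_ball.2 (by have := hvert t ht; rw [hr₀]; linarith)
    have hsub : ball (simplexCentre y T) (lam + 1 / 2) ⊆ ball c r₀ := fun v hv => mem_ball.2 (by
      have := dist_triangle v (simplexCentre y T) c
      rw [hr₀]; linarith [mem_ball.1 hv])
    have hlab := H.labelDist_eq_of_isCentredSimplex hα hα200 hsep hTc hlam hsub
    refine ⟨h3, hball, hlab, fun t ht => ?_⟩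
    -- refined position bound from (61): sides `≤ 1.005 λ`
    have hside : ∀ t' ∈ T, dist (y t') (y t) ≤ 201 / 200 * lam := by
      intro t' ht'
      by_cases htt' : t' = t
      · rw [htt', dist_self]; positivity
      have h1 := H.lower (hball t' ht') (hball t ht)
      rw [hlab t' ht' t ht htt'] at h1
      nlinarith [dist_nonneg (x := y t') (y := y t)]
    obtain ⟨p, hpS', hpT⟩ := hne T hfT
    have hpt : dist p (y t) ≤ 201 / 200 * lam := dist_le_of_mem_convexHull_of_forall hside hpT
    have htc : dist (y t) c ≤ 201 / 200 * lam + (1 + α) := by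
      have := dist_triangle (y t) p c
      rw [dist_comm] at hpt; linarith [hpS p hpS']
    intro v hv
    rw [mem_ball] at hv ⊢
    have := dist_triangle v (y t) c
    rw [hr₀]; linarith
  -- two distinct labelled vertices and the class of a good simplex
  have hpair : ∀ T ∈ simplicesAt α y lam, f T ≠ 0 →
      ∃ a b, a ∈ T ∧ b ∈ T ∧ a ≠ b ∧ Φ b - Φ a ∈ shell lam := by
    intro T hT hfT
    obtain ⟨h3, -, hlab, -⟩ := good T hT hfT
    obtain ⟨a, b, x, hab, -, -, rfl⟩ := Finset.card_eq_three.1 h3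
    refine ⟨a, b, by simp, by simp, hab, ?_, ?_⟩
    · intro h0
      have := hlab b (by simp) a (by simp) hab.symm
      rw [dist_triPoint, h0, map_zero, norm_zero] at this
      linarith
    · rw [← dist_triPoint]; exact hlab b (by simp) a (by simp) hab.symm
  obtain ⟨a₀, b₀, -, -, -, hab₀⟩ := hpair T₀ hT₀ hfT₀
  let κ₀ : ClassIdx lam := classOf hab₀
  let cls : Finset (Fin N) → ClassIdx lam := fun T =>
    if h : ∃ a b, a ∈ T ∧ b ∈ T ∧ a ≠ b ∧ Φ b - Φ a ∈ shell lam then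
      classOf h.choose_spec.choose_spec.2.2.2 else κ₀
  have hcls : ∀ T ∈ simplicesAt α y lam, f T ≠ 0 → ∀ t ∈ T, Φ t ∈ cosetOf (cls T) := by
    intro T hT hfT t ht
    have h := hpair T hT hfT
    have hc : cls T = classOf h.choose_spec.choose_spec.2.2.2 := by
      simp only [cls, dif_pos h]
    rw [hc]
    obtain ⟨ha, hb, hab, hsh⟩ := h.choose_spec.choose_spec
    set a := h.choose
    set b := h.choose_spec.choose
    obtain ⟨-, -, hlab, -⟩ := good T hT hfT
    by_cases hta : t = a
    · rw [hta]; exact left_mem_cosetOf_classOf hsh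
    by_cases htb : t = b
    · rw [htb]; exact right_mem_cosetOf_classOf hsh
    exact third_mem_cosetOf_classOf hsh (hlab t ht a ha hta) (hlab t ht b hb htb)
  -- split the sum over the classes
  letI : Fintype (ClassIdx lam) := Fintype.ofFinite _
  set 𝒯p := (simplicesAt α y lam).filter (fun T => f T ≠ 0) with h𝒯p
  have hmem𝒯p : ∀ {T}, T ∈ 𝒯p ↔ T ∈ simplicesAt α y lam ∧ f T ≠ 0 := by
    intro T; rw [h𝒯p, Finset.mem_filter]
  rw [← Finset.sum_filter_ne_zero, ← h𝒯p, ← Finset.sum_fiberwise 𝒯p cls f]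
  -- per class: the pieces are a.e. disjoint subsets of `conv y(S)`
  have hfib : ∀ κ : ClassIdx lam, ∑ T ∈ 𝒯p.filter (fun T => cls T = κ), f T ≤ (volume CS).toReal := by
    intro κ
    set F := 𝒯p.filter (fun T => cls T = κ) with hF
    have hmemF : ∀ {T}, T ∈ F → T ∈ simplicesAt α y lam ∧ f T ≠ 0 ∧ cls T = κ := by
      intro T hT
      rw [hF, Finset.mem_filter] at hT
      exact ⟨(hmem𝒯p.1 hT.1).1, (hmem𝒯p.1 hT.1).2, hT.2⟩
    have hpatch : ∀ {T}, T ∈ F → ∀ z ∈ T, z ∈ classPatch y Φ c r₀ κ := by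
      intro T hT z hz
      obtain ⟨hT𝒯, hfT, hcT⟩ := hmemF hT
      exact ⟨(good T hT𝒯 hfT).2.1 z hz, hcT ▸ hcls T hT𝒯 hfT z hz⟩
    have hdisj : (↑F : Set (Finset (Fin N))).Pairwise
        (Function.onFun (AEDisjoint volume) fun T => CS ∩ convexHull ℝ (y '' ↑T)) := by
      intro T hT T' hT' hne'
      obtain ⟨hT𝒯, hfT, -⟩ := hmemF hT
      obtain ⟨hT'𝒯, hfT', -⟩ := hmemF hT'
      obtain ⟨h3, -, hlab, hin⟩ := good T hT𝒯 hfT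
      obtain ⟨h3', -, hlab', hin'⟩ := good T' hT'𝒯 hfT'
      have h0 := H.volume_inter_eq_zero_of_class hα hK hα' hne' (hpatch hT) (hpatch hT') h3 h3'
        hlab hlab' hin hin'
      change volume ((CS ∩ convexHull ℝ (y '' ↑T)) ∩ (CS ∩ convexHull ℝ (y '' ↑T'))) = 0
      refine measure_mono_null (fun v hv => ?_) h0
      exact ⟨hv.1.2, hv.2.2⟩
    have hU : volume (⋃ T ∈ F, CS ∩ convexHull ℝ (y '' ↑T)) =
        ∑ T ∈ F, volume (CS ∩ convexHull ℝ (y '' ↑T)) :=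
      measure_biUnion_finset₀ hdisj fun T _ => (measurableSet_inter_convexHull S T).nullMeasurableSet
    have hle : volume (⋃ T ∈ F, CS ∩ convexHull ℝ (y '' ↑T)) ≤ volume CS :=
      measure_mono (iUnion₂_subset fun T _ => inter_subset_left)
    have hfin : ∀ T ∈ F, volume (CS ∩ convexHull ℝ (y '' ↑T)) ≠ ⊤ := fun T _ =>
      (lt_of_le_of_lt (measure_mono inter_subset_left) (volume_convexHull_lt_top S)).ne
    calc ∑ T ∈ F, f T = (∑ T ∈ F, volume (CS ∩ convexHull ℝ (y '' ↑T))).toReal := by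
          rw [ENNReal.toReal_sum hfin]
      _ ≤ (volume CS).toReal := by
          rw [← hU]; exact ENNReal.toReal_mono hμS hle
  calc ∑ κ : ClassIdx lam, ∑ T ∈ 𝒯p.filter (fun T => cls T = κ), f T
      ≤ ∑ _κ : ClassIdx lam, (volume CS).toReal := Finset.sum_le_sum fun κ _ => hfib κ
    _ = m lam * lam ^ 2 * (volume CS).toReal := by
        rw [Finset.sum_const, Finset.card_univ, nsmul_eq_mul, ← Nat.card_eq_fintype_card,
          natCard_classIdx]

end UpperBound

section LowerBound

variable {α K : ℝ} {N : ℕ} {y : Fin N → Plane}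

/-- **(72), lower half: `m(λ) λ² meas(conv y(S)) ≤ Σ_{T ∈ 𝒯_λ} meas(conv y(S) ∩ conv y(T))` for
every unit simplex `S` farther than `28λ` from the defects** — given Proposition 4.8 at `α`.  One
rigid chart about `y(s₁)` of radius `7λ − ½`; every class has a particle within `2λ` of `y(s₁)`
(cosets are `λ`-dense, (62)); the coarse triangles of each class cover `conv y(S)` ((63) for the
rescaled class sub-configuration); each of them is a centred `λ`-simplex of `y`
(`IsRigidChart.isCentredSimplex_of_labels`); different classes give different simplices.
[cite: Theil2006, Appendix proof of Proposition 2.9 (27), display (72) with "`=` if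
`dist(y(S), y(∂X)) > 28λ`" (preprint p. 25); our proof] -/
theorem le_sum_volume_inter (hα : 0 < α) (hK : 0 ≤ K) (hα' : (2 * K + 1) * α ≤ 1 / 200)
    (hsep : ∀ i j : Fin N, i ≠ j → 1 - α < dist (y i) (y j))
    (h48α : ∀ (c' : Plane) (r R : ℝ), 2 ≤ r → 4 * r + 2 ≤ R →
      (∀ b ∈ defectSet α y, R ≤ dist (y b) c') →
        ∃ Ψ : Fin N → ℤ × ℤ, IsDiscreteImbeddingOn α y (y ⁻¹' ball c' r) Ψ ∧
          ∀ x x' : Fin N, y x ∈ ball c' r → y x' ∈ ball c' r → x ≠ x' →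
            |dist (triPoint (Ψ x)) (triPoint (Ψ x')) / dist (y x) (y x') - 1| ≤ K * α)
    {lam : ℝ} (hlam : √3 ≤ lam) {S : Finset (Fin N)} (hS : IsEquilateralSimplex α y 1 S)
    (hfar : ∀ x ∈ S, ∀ b ∈ defectSet α y, 28 * lam < dist (y x) (y b)) :
    m lam * lam ^ 2 * (volume (convexHull ℝ (y '' ↑S))).toReal ≤
      ∑ T ∈ simplicesAt α y lam,
        (volume (convexHull ℝ (y '' ↑S) ∩ convexHull ℝ (y '' ↑T))).toReal := by
  classical
  have h173 := sqrt_three_gt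
  have hlam1 : 1 < lam := by linarith
  have hlam0 : 0 < lam := by linarith
  have hα1 : α < 1 := by nlinarith
  have hα200 : α ≤ 1 / 200 := by nlinarith
  have hKα0 : 0 ≤ K * α := by positivity
  set CS := convexHull ℝ (y '' ↑S) with hCS
  set f : Finset (Fin N) → ℝ := fun T => (volume (CS ∩ convexHull ℝ (y '' ↑T))).toReal with hf
  have hf0 : ∀ T, 0 ≤ f T := fun T => ENNReal.toReal_nonneg
  -- the centre `c = y(s₁)` and the chart of radius `7λ − ½`
  obtain ⟨s₁, hs₁⟩ : S.Nonempty := by rw [← Finset.card_pos, hS.card_eq_three]; norm_num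
  set c : Plane := y s₁ with hc
  have hpS : ∀ p ∈ CS, dist p c ≤ 1 + α := fun p hp =>
    dist_le_of_mem_convexHull_unitSimplex hα.le hS hs₁ hp
  have hdefc : ∀ b ∈ defectSet α y, 28 * lam ≤ dist (y b) c := fun b hb => by
    rw [dist_comm]; exact (hfar s₁ hs₁ b hb).le
  set r₁ : ℝ := 7 * lam - 1 / 2 with hr₁
  obtain ⟨Φ, hΦ, h61⟩ := h48α c r₁ (28 * lam) (by rw [hr₁]; linarith) (by rw [hr₁]; linarith) hdefc
  have H : IsRigidChart α K y c r₁ Φ := isRigidChart_of_quotient hα1 hsep hΦ h61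
    (fun b hb => by have := hdefc b hb; rw [hr₁]; linarith)
  -- the good coarse triangles of a class
  let Good : ClassIdx lam → Finset (Fin N) → Prop := fun κ T =>
    (∀ z ∈ T, z ∈ classPatch y Φ c r₁ κ) ∧ T.card = 3 ∧
      (∀ z ∈ T, ∀ z' ∈ T, z ≠ z' → dist (triPoint (Φ z)) (triPoint (Φ z')) = lam) ∧
      ∀ z ∈ T, y z ∈ ball c (lam * (2 + 2))
  let G : ClassIdx lam → Finset (Finset (Fin N)) := fun κ => Finset.univ.filter (Good κ)
  have hmemG : ∀ {κ T}, T ∈ G κ ↔ Good κ T := by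
    intro κ T; simp only [G, Finset.mem_filter, Finset.mem_univ, true_and]
  -- every good triangle is a `λ`-simplex of `y`
  have hG𝒯 : ∀ κ, G κ ⊆ simplicesAt α y lam := by
    intro κ T hT
    obtain ⟨-, h3, hlab, hball⟩ := hmemG.1 hT
    refine mem_simplicesAt.2 (H.isCentredSimplex_of_labels hα hK hα' hsep hlam
      (by rw [hr₁]; linarith) hdefc h48α h3 (fun t ht => ?_) hlab)
    have := hball t ht
    rwa [show lam * (2 + 2) = 4 * lam by ring] at this
  letI : Fintype (ClassIdx lam) := Fintype.ofFinite _
  -- the good families of different classes are disjoint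
  have hGdisj : (↑(Finset.univ : Finset (ClassIdx lam)) : Set (ClassIdx lam)).PairwiseDisjoint G := by
    intro κ _ κ' _ hne
    rw [Function.onFun, Finset.disjoint_left]
    intro T hT hT'
    obtain ⟨hP, h3, hlab, -⟩ := hmemG.1 hT
    obtain ⟨hP', -, -, -⟩ := hmemG.1 hT'
    obtain ⟨a, b, x, hab, -, -, rfl⟩ := Finset.card_eq_three.1 h3
    exact hne (classIdx_eq_of_edge (hP a (by simp)).2 (hP b (by simp)).2 (hP' a (by simp)).2
      (hP' b (by simp)).2 (hlab b (by simp) a (by simp) hab.symm))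
  -- every class covers `conv y(S)`
  have hcov : ∀ κ, (volume CS).toReal ≤ ∑ T ∈ G κ, f T := by
    intro κ
    -- a class particle within `2λ` of `c`
    obtain ⟨g, hg, hgd⟩ := exists_mem_cosetOf_dist_lt κ (Φ s₁)
    have hs₁ball : y s₁ ∈ ball c r₁ := by
      rw [hc, mem_ball, dist_self, hr₁]; linarith
    have hballs : ∀ b, dist (y b) (y s₁) < 21 / 10 * lam → b ∈ y ⁻¹' ball c r₁ := fun b hb => by
      show y b ∈ ball c r₁
      rw [mem_ball, hc, hr₁]; linarith
    have hdefs : ∀ b, dist (y b) (y s₁) < 21 / 10 * lam → b ∉ defectSet α y := fun b hb =>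
      H.not_mem_defectSet (hballs b hb)
    obtain ⟨x₀, hx₀d, hx₀g⟩ := H.imbedding.exists_eq_of_dist_lt_half' hα.le (by linarith) hballs
      hdefs (g := g) (by linarith)
    have hx₀c : dist (y x₀) c < lam * 2 := by rw [hc]; linarith
    have hx₀P : x₀ ∈ classPatch y Φ c r₁ κ :=
      ⟨mem_ball.2 (by rw [hr₁]; linarith), by rw [hx₀g]; exact hg⟩
    have hcover := H.ball_subset_biUnion_class hα hK hα' (r' := 2) (by rw [hr₁]; linarith) hx₀P
      (mem_ball.2 hx₀c)
    -- `conv y(S) ⊂ B(c, 2λ)` is covered by the good triangles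
    have hCSsub : CS ⊆ ⋃ T ∈ G κ, CS ∩ convexHull ℝ (y '' ↑T) := by
      intro p hp
      have hpb : p ∈ ball c (lam * 2) := mem_ball.2 (by linarith [hpS p hp])
      obtain ⟨T, hT, hpT⟩ := mem_iUnion₂.1 (hcover hpb)
      exact mem_iUnion₂.2 ⟨T, hmemG.2 hT, hp, hpT⟩
    have hfin : ∀ T ∈ G κ, volume (CS ∩ convexHull ℝ (y '' ↑T)) ≠ ⊤ := fun T _ =>
      (lt_of_le_of_lt (measure_mono inter_subset_left) (volume_convexHull_lt_top S)).ne
    calc (volume CS).toReal ≤ (volume (⋃ T ∈ G κ, CS ∩ convexHull ℝ (y '' ↑T))).toReal :=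
          ENNReal.toReal_mono ((measure_biUnion_finset_le _ _).trans_lt
            (ENNReal.sum_lt_top.2 fun T hT => (hfin T hT).lt_top)).ne (measure_mono hCSsub)
      _ ≤ (∑ T ∈ G κ, volume (CS ∩ convexHull ℝ (y '' ↑T))).toReal :=
          ENNReal.toReal_mono (ENNReal.sum_lt_top.2 fun T hT => (hfin T hT).lt_top).ne
            (measure_biUnion_finset_le _ _)
      _ = ∑ T ∈ G κ, f T := by rw [ENNReal.toReal_sum hfin]
  -- assemble
  have hsub : Finset.univ.biUnion G ⊆ simplicesAt α y lam :=
    Finset.biUnion_subset.2 fun κ _ => hG𝒯 κ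
  calc m lam * lam ^ 2 * (volume CS).toReal
      = ∑ _κ : ClassIdx lam, (volume CS).toReal := by
        rw [Finset.sum_const, Finset.card_univ, nsmul_eq_mul, ← Nat.card_eq_fintype_card,
          natCard_classIdx]
    _ ≤ ∑ κ : ClassIdx lam, ∑ T ∈ G κ, f T := Finset.sum_le_sum fun κ _ => hcov κ
    _ = ∑ T ∈ Finset.univ.biUnion G, f T := (Finset.sum_biUnion hGdisj).symm
    _ ≤ ∑ T ∈ simplicesAt α y lam, f T :=
        Finset.sum_le_sum_of_subset_of_nonneg hsub fun T _ _ => hf0 T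

end LowerBound

/-- **Theil 2006, Appendix p. 25, display (72) — the measure bookkeeping of the proof of
Proposition 2.9 (27) — from Proposition 4.8 (existence of rigid discrete imbeddings of defect-free
discs, hypothesis (H48′) of `Theil2006_mainTheorems_of_existsRigidReference`).**  For all small `α`,
all finite configurations with (13), all `λ ∈ Λ ∖ {1}` and all unit simplices `S ∈ 𝒯₁(y)`:
`Σ_{T ∈ 𝒯_λ(y)} meas(conv y(S) ∩ conv y(T)) ≤ m(λ) λ² meas(conv y(S))`, with `≥` (hence
equality) when `dist(y(S), y(∂X)) > 28λ` — the printed "`n(S, λ) ≤ λ² m(λ)` and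
`n(S, λ) = λ² m(λ)` if `dist(y(S), y(∂X)) > 28λ`".  This is exactly hypothesis (H72) of
`Theil2006_mainTheorems_of_existsRigidReference`.  The print's reason ("there are precisely
`6 m(λ)` sets `{η₁, η₂, η₃} ⊂ A₂` …") is replaced by the class-by-class tiling of
`Theil2006CoarseTiling` (module docstring). [cite: Theil2006, Appendix proof of Proposition 2.9
(27), display (72) (preprint p. 25)] -/
theorem measureBookkeeping_of_existsRigid
    (h48 : ∃ α₀ K : ℝ, 0 < α₀ ∧ 0 ≤ K ∧ ∀ ⦃α : ℝ⦄, 0 < α → α < α₀ →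
      ∀ {N : ℕ} (y : Fin N → Plane), (∀ i j : Fin N, i ≠ j → 1 - α < dist (y i) (y j)) →
      ∀ (c : Plane) (r R : ℝ), 2 ≤ r → 4 * r + 2 ≤ R → (∀ b ∈ defects α y, R ≤ dist (y b) c) →
        ∃ Φ : Fin N → ℤ × ℤ, IsDiscreteImbeddingOn α y (y ⁻¹' ball c r) Φ ∧
          (∀ x x' : Fin N, y x ∈ ball c r → y x' ∈ ball c r → x ≠ x' →
            |dist (triPoint (Φ x)) (triPoint (Φ x')) / dist (y x) (y x') - 1| ≤ K * α)) :
    ∃ α₂ : ℝ, 0 < α₂ ∧ ∀ ⦃α : ℝ⦄, 0 < α → α < α₂ →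
      ∀ {N : ℕ} (y : Fin N → Plane), (∀ i j : Fin N, i ≠ j → 1 - α < dist (y i) (y j)) →
      (∀ lam : ↥(distSet \ {1}), ∀ S ∈ unitSimplices α y,
        ∑ T ∈ simplicesAt α y lam,
            (volume (convexHull ℝ (y '' ↑S) ∩ convexHull ℝ (y '' ↑T))).toReal ≤
          m (lam : ℝ) * (lam : ℝ) ^ 2 * (volume (convexHull ℝ (y '' ↑S))).toReal) ∧
      (∀ lam : ↥(distSet \ {1}), ∀ S ∈ unitSimplices α y,
        (∀ x ∈ S, ∀ b ∈ defects α y, 28 * (lam : ℝ) < dist (y x) (y b)) →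
        m (lam : ℝ) * (lam : ℝ) ^ 2 * (volume (convexHull ℝ (y '' ↑S))).toReal ≤
          ∑ T ∈ simplicesAt α y lam,
            (volume (convexHull ℝ (y '' ↑S) ∩ convexHull ℝ (y '' ↑T))).toReal) := by
  obtain ⟨α₀, K, hα₀, hK, h48⟩ := h48
  refine ⟨min α₀ (1 / (200 * (2 * K + 1))), lt_min hα₀ (by positivity), ?_⟩
  intro α hα hαlt N y hsep
  have hα1 : α < α₀ := hαlt.trans_le (min_le_left _ _)
  have hα' : (2 * K + 1) * α ≤ 1 / 200 := by
    have h := (hαlt.trans_le (min_le_right _ _)).le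
    rw [le_div_iff₀ (by positivity)] at h
    rw [le_div_iff₀ (by norm_num : (0 : ℝ) < 200)]
    linarith
  have h48α : ∀ (c' : Plane) (r R : ℝ), 2 ≤ r → 4 * r + 2 ≤ R →
      (∀ b ∈ defectSet α y, R ≤ dist (y b) c') →
        ∃ Ψ : Fin N → ℤ × ℤ, IsDiscreteImbeddingOn α y (y ⁻¹' ball c' r) Ψ ∧
          ∀ x x' : Fin N, y x ∈ ball c' r → y x' ∈ ball c' r → x ≠ x' →
            |dist (triPoint (Ψ x)) (triPoint (Ψ x')) / dist (y x) (y x') - 1| ≤ K * α :=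
    fun c' r R hr hR hdef => h48 hα hα1 y hsep c' r R hr hR
      (fun b hb => hdef b (mem_defects_iff_defectSet.1 hb))
  have hlam : ∀ lam : ↥(distSet \ {1}), √3 ≤ (lam : ℝ) := fun lam =>
    sqrt_three_le_of_mem_distSet lam.2.1 lam.2.2
  refine ⟨fun lam S hS => ?_, fun lam S hS hfar => ?_⟩
  · exact sum_volume_inter_le hα hK hα' hsep h48α (hlam lam) (mem_unitSimplices_iff.1 hS)
  · exact le_sum_volume_inter hα hK hα' hsep h48α (hlam lam) (mem_unitSimplices_iff.1 hS)
      (fun x hx b hb => hfar x hx b (mem_defects_iff_defectSet.2 hb))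

end Theil2006

end Literature.MathematicalPhysics.StatisticalMechanics
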